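import Summits.QuantumFields.YangMills.Theorems.BackwardLiouvilleRigidityOneStepBackwardContractionAdmDescentDisintegration
import HarnessLib

/-!

**BANNER (v2.7, critic idea-crit-5 #545 (i) + #542 (R1); P26-1): rows 2–3 of this line — BGEV∘ `ClassicalTransportCan` (SUPERSEDED: mis-centred, and bet (ii) FIRES in the
typed currency, FL-17 j341016 (2b) A4 — MUST-RETYPE-OR-WITHDRAW, EMBARGO-LITE) and FLUC∘ `FluctuationCorrectionCan` (WITHDRAWN-BY-AUTHOR: false in the Gaussian model) — are
SUPERSEDED BY `Lines/mode_section.lean` (MODE∘ ∕ TRM∘ ∕ LAP∘; TRM∘ itself under re-typing, `CURRENCY-MEMO-g26.md`).  MIN∘ `MinimiserSectionCan` survives as a valid row with no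
consumer; ★1∕★2∕★3 stay kernel-correct implications.  Texts below are kept byte-identical for the record (negative knowledge); no prover is to be attached to rows 2–3.**
R-CUT-χ (2026-08-30 ≈19:3xZ, g26; LEAD w3 g23 WORD №1 (iii) «R-CUT-χ», ideator №3 GO): the `sfCut` numerals (½, ¾) ↦ (½, 24∕25) —
`sfCut θ U = ∏ p, max 0 (min 1 ((24/25·θ − dist1 (plaqHol U p)) / ((24/25 − 1/2)·θ)))`: `= 1` iff every `dist1 ≤ θ/2` (unchanged), `= 0` iff some
`dist1 ≥ (24/25)θ`, `{sfCut > 0} = {PlaqSmall ((24/25)θ)}` — so that the one-step spread lifts the fibre-mean rows need exist for EVERY odd block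
size `L ≥ 3` from LANDED kernels (gain `0.9482·` at `L = 3` < 24/25; LEAD (M3) letter).  Every row ∕ junction text not naming the constant is
byte-identical to the previous version.

# LINE g25-2 «tangent_classical_quantum» v2.6 — the tangent row LIN∘ cut into CLASSICAL TRANSPORT through the constrained
# minimiser and the QUANTUM (fluctuation) CORRECTION
# (crux stmt-QuantumFields-20520 `FluctuationComparisonRegPrIntL`, PATH B package `runpair_organ` v17.1 (smooth cut), parent LINE g25-1
# `Lines/organ_tangent.lean` v2.5)

v2.5 (≈18:3xZ): frame = O1 v17.1's (SMOOTH tower cut; (R1)); bodies byte-identical to v2.4∕v2.3.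

v2.4 (2026-08-30, g25; ★★OWNER g37 №139 ∕ RULING №54, LEAD w3 g22; D25-8; critic g14 #527∕#531 Q1): rows RE-COPIED BY SCRIPT over O1 v17's
FRAME (anchored to the run family `ν` and a pair `K ≤ K'`; towers = runs on `[Ts, T]`, SF-projections below the seed; sub-probability;
membership modulo a constant factor; step for `j + 1 ≤ Ts`); MIN∘ is tower-free and BYTE-IDENTICAL to v2.3; BGEV∘∕FLUC∘∕LIN∘ bodies
byte-identical to v2.3, frame replaced.  The pre-v17 rows were provable by emptiness over the normalised generic frame (Q1).

bears_on: R3:stmt-QuantumFields-20520 [ym-r3-idea-1-g25] · LENS «control» (the tangent map of the backward step = composition with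
the classical background section + a small linear correction; the Lyapunov currency `x = a + Θ·w` is transported by each part separately).

HONESTY.  Nothing of Bałaban's is asserted here; every row is a `def … : Prop`, every `stub_*` is a `sorry`, and the only
kernel-checked content is the three ★ junctions.  Item 20520 and the rung leaf `…T3YM3TorusStatement.YM3TorusSU2` are NOT proved.
R3 = SU(2) YM₃ on T³ — NOT d = 4, NOT infinite volume, NOT a mass gap, NOT Clay.  No summit is proved by a line.

v2 (2026-08-30): follows organ_tangent v2 — `m` is the SMALL-FIELD-LOCALISED fibre mean `E′_χ[h | ·]`, `χ = sfCut θ_{j+1}` (exit γ′ to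
idea-crit-5 #514 (ii); census D25-4), VER∘ is unconditional; O1 and the κ-heads of BGEV∘/FLUC∘/LIN∘/JEN∘ follow `Lines/runpair_organ.lean`
v16 (O1-R1 «κ-CEILING»: `∃ κ₀ > 0, ∀ κ ∈ (0, κ₀]`).

THE CUT.  LIN∘ `TangentTransportCan` (g25-1 v2, restated verbatim) says: the window-continuous localised fibre mean `m = E′_χ[h | descend = ·]` of the
fine discrepancy `h = log ρ_{j+1} − log ρ′_{j+1}` (presentation `(c, a, w)`, currency `x = a + Θ_{j+1} w`) has a coarse presentation with
`a′ + Θ_j w′ ≤ (1 + ε_j + εd_n)·x + δ_j`.  Write, for a CONSTRAINED-MINIMISER SECTION `U⋆ : T_j → T_{j+1}` of Bałaban's averaging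
(`descend (U⋆ V) = V`, `U⋆ V` in the fine window, `A(U⋆ V) ≤ A(U)` for every fine-window `U` over `V`, `U⋆` continuous on the window),
    `m = h ∘ U⋆ + (m − h ∘ U⋆)`   (classical restriction + fluctuation correction).
* MIN∘ `MinimiserSectionCan` — such a section exists from some height on ([Balaban1985Variational] Thm 1: existence, smallness (8)–(10),
  regularity of the minimal orbit; here over the fine Bałaban window of the family);
* BGEV∘ `ClassicalTransportCan` — CLASSICAL, measure-free in its conclusion: composition with `U⋆` transports the currency with the factor
  `(1 + ε_j + εd_n)·x + δ_j` (marginal: `A_{j+1} ∘ U⋆ = (1/L)·A_j + quasi-local spreading`, `β_{j+1} = L β_j`, block-averaged coefficients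
  `c⋆_P = L⁻³ Σ_{p ∈ B(P)} c_p`; remainders: the minimiser's response to a one-bond move of `V` decays exponentially, so 4-point
  presentations pull back with `L³·(response sum)` absorbed by `p(g_j)²/p(g_{j+1})²·L`; the equilibrated off-Wilson content of CLASS inputs
  moves `Q_n → Q_{n+1}` at cost `εd_n` — this row now carries the whole KT-W equilibration bet);
* FLUC∘ `FluctuationCorrectionCan` — QUANTUM but SMALL: `m − h ∘ U⋆` has a presentation with `a″ + Θ_j w″ ≤ ε_j·x + δ_j` (NO `1·x` term:
  at one loop `E′[h | V] − h(U⋆ V) = ½ tr(G_V ∇²h(U⋆ V)) + ⟨∇h, E′ζ⟩`; for the marginal direction the trace is a `V`-INDEPENDENT constant and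
  the tadpole vanishes on the fibre tangent space (KKT), so only the `V`-dependence of the fibre covariance and of the quantum shift of
  the background survive, relative size `O(g_j²/θ)`; for clustered remainders the trace term is down by `O(1/(L³ p(g_j)²))` in marginal
  units — summable, only polynomially);
★ `tangentTransport_of_classicalQuantum : MIN∘ → BGEV∘ → FLUC∘ → LIN∘` (c′ := c⋆ + c″, a′ := a⋆ + a″, w′ := w⋆ + w″, ε := εᴮ + εᶠ,
δ := δᴮ + δᶠ, θ₀ := min, γ₁ := min(·,·,1), j₁ := max; pointwise `m − β_jΣ(c⋆+c″)g = (h∘U⋆ − β_jΣc⋆g) + ((m − h∘U⋆) − β_jΣc″g)`), and,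
with g25-1's junction re-proved here verbatim, ★ `oneStepContractionRun_of_classicalQuantumCut : VER∘ → MIN∘ → BGEV∘ → FLUC∘ → JEN∘ → O1`.

DICTIONARY (transplant, explicit).  BGEV∘'s marginal channel iterated is the CLASSICALLY PERFECT ACTION recursion of Hasenfratz–Niedermayer
/ DeGrand–Hasenfratz–Hasenfratz–Niedermayer: `S^{FP}(V) = min_U (S^{FP}(U) + T(U,V))` (arXiv:hep-lat/9506030 §3 Eq. (9)–(10)), their
blocking kernel `T` at `κ = ∞` ↦ Bałaban's sharp averaging constraint `descend U = V`; their quadratic recursion `D^{(n)} → D^{(n+1)}` and its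
`n → ∞` limit `ρ_{μν}` (§4 Eq. (21)–(26), solved analytically) ↦ the equilibrated marginal directions `Q_n → Q_∞` of KT-W and the defects
`εd_n`; their connecting tensor `Z_{μν}` («decays rapidly with distance; the minimizing configuration is determined locally by the coarse
vector potential», p.9) ↦ the response decay of `U⋆` used for the 4-point pull-back ([Balaban1985Variational] Prop. 9; cell Theorems
(RESPᵛ²)/(E2Eᵛ²) of the background_form v2 cone).  What is NOT transplanted: HN work in d = 4 with a smooth `κ`-kernel and factor-2 blocking
and never bound a two-tower discrepancy; here d = 3, `L`-blocking, sharp constraint, and the currency is the route's.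
INSTRUMENT ALIGNMENT (instr-1 g12 dictionary 15:45:57Z): F1 = «(T) for the marginal direction IS the classical transport» = BGEV∘'s content,
FLUC∘ = the `O(1/(β_{j+1}θ))` terms the rig of record omits; F2(a) = the linearised transport `Q_n ↦ Q_{n+1}` iterated from Wilson = BGEV∘'s
cheapest falsifier (summability of the currency-ratio defects `εd_n`).

KT-W honoured: every bound is on the COMBINED currency of an input from two CLASS towers (B-8(a): O1's tower block verbatim, Mem at `j+1`,
`j+2 ≤ T`); a Wilson-exact input would jump by `κ_geom·θ` under BGEV∘ (instrument F2) — excluded exactly as in O1/LIN∘ by class membership in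
depth, and that exclusion is BGEV∘'s declared risk.  Rows restated BY TEXT (never imported): O1 = `RunPairOrgan.OneStepContractionRun`
(runpair_organ v16, O1-R1 text), VER∘/LIN∘/JEN∘ = `OrganTangent.FibreMeanVersionCan/TangentTransportCan/JensenGapCan` (organ_tangent.lean v2,
byte-identical bodies; helper `sfCut` restated identically).  Landed organ used BY NAME: `FibreLaplace.stub_descentDisintegration` (D).
-/

open MeasureTheory Filter Topology
open Literature.MathematicalPhysics.QuantumFieldTheory.Balaban1983to89 T3ContinuumYM3Torus T3NestedUnitLaws
  T3UnitLawDensityEML T4Continuum BalabanUVClass T3UnitScaleTilt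

namespace Summit.QuantumFields.YangMills.Cruxes.FluctuationComparisonRegPrIntL.TangentClassicalQuantum

/-- The CONTINUOUS SMALL-FIELD CUTOFF on fine fields (restated BY TEXT from organ_tangent.lean v2.1, byte-identical: support `{∀ p, dist1 ≤ (24∕25)θ}`,
compact inside the open window `{PlaqSmall θ}`; `= 1` on `{∀ p, dist1 ≤ θ/2}`). -/
noncomputable def sfCut {P : Params} {k : ℕ} (θ : ℝ) (U : GaugeField P k ↥(Matrix.specialUnitaryGroup (Fin 2) ℂ)) : ℝ :=
  ∏ p : Plaq P k, max 0 (min 1 ((24 / 25 * θ - dist1 (GaugeField.plaqHol U p)) / ((24 / 25 - 1 / 2) * θ)))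

/-- O1 · the one-step organ (v17 = R-c + R-a + R-n4), restated BY TEXT (byte-identical with `RunPairOrgan.OneStepContractionRun` of runpair_organ v17.1 (smooth cut),
HOME bytes `runpair_organ.v171.lean`, and with `OrganTangent.OneStepContractionRun` v2.5). -/
def OneStepContractionRun : Prop :=
  ∃ γ₁ : ℝ, 0 < γ₁ ∧ ∀ (F : T3Family) (γ : ℝ), 0 < γ → γ ≤ γ₁ → ∀ (b₀ p₀ : ℝ) (j₀ : ℕ) (prm : ℕ → ClassParams) (η : ℕ → ℝ), 0 < b₀ → 0 < p₀ → AdmissibleClassParams F γ b₀ p₀ prm → (∀ j, 0 ≤ η j) → Summable η → Summable (fun i => ∑' k, η (k + i)) → Tendsto (fun j => (∑' k, η (k + j)) * ((1 + 2 * ((F.L : ℝ) ^ j / γ) * (Fintype.card (Plaq (F.P j) 0) : ℝ)) * (Fintype.card (PBond (F.P j) 0) : ℝ) ^ 2)) atTop (𝓝 0) → ∃ κ₀ : ℝ, 0 < κ₀ ∧ ∀ (κ : ℝ), 0 < κ → κ ≤ κ₀ → ∃ (θ C w₀ : ℝ) (ε εd δ : ℕ → ℝ) (j₁ : ℕ),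 0 < θ ∧ 0 ≤ C ∧ 0 < w₀ ∧ (∀ j, 0 ≤ ε j ∧ 0 ≤ εd j ∧ 0 ≤ δ j) ∧ Summable ε ∧ Summable εd ∧ Summable δ ∧ Summable (fun i => ∑' k, δ (k + i)) ∧ Tendsto (fun j => (∑' k, δ (k + j)) * ((1 + 2 * ((F.L : ℝ) ^ j / γ) * (Fintype.card (Plaq (F.P j) 0) : ℝ)) * (Fintype.card (PBond (F.P j) 0) : ℝ) ^ 2)) atTop (𝓝 0) ∧ j₀ ≤ j₁ ∧ ∀ (ν : ℕ → (j : ℕ) → MeasureTheory.Measure (GaugeField (F.P j) 0 ↥(Matrix.specialUnitaryGroup (Fin 2) ℂ))), (∀ K, ν K K = T4GenFunBounds.gibbsMeasure (F.P K) ((F.scheme ℰp γ).β K)) → (∀ K j, j < K → ν K j = Measure.map (descend F ℰp j) (ν K (j + 1))) → ∀ (K K' : ℕ), K ≤ K' → ∀ (Ts T : ℕ), Ts < T → T ≤ K → ∀ (μ μ' : ((j : ℕ) → MeasureTheory.Measure (GaugeField (F.P j) 0 ↥(Matrix.specialUnitaryGroup (Fin 2) ℂ)))) (ρ ρ' : ((j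 : ℕ) → GaugeField (F.P j) 0 ↥(Matrix.specialUnitaryGroup (Fin 2) ℂ) → ℝ)), (∀ j : ℕ, Ts ≤ j → j ≤ T → μ j = ν K j ∧ μ' j = ν K' j) → (∀ j : ℕ, j < Ts → μ j = Measure.map (descend F ℰp j) ((μ (j + 1)).withDensity (fun U => ENNReal.ofReal (sfCut (θBal F.L γ b₀ p₀ (j + 1)) U))) ∧ μ' j = Measure.map (descend F ℰp j) ((μ' (j + 1)).withDensity (fun U => ENNReal.ofReal (sfCut (θBal F.L γ b₀ p₀ (j + 1)) U)))) → (∀ j : ℕ, Ts ≤ j → j < T → μ j = Measure.map (descend F ℰp j) (μ (j + 1)) ∧ μ' j = Measure.map (descend F ℰp j) (μ' (j + 1))) → (∀ j : ℕ, j ≤ T → IsFiniteMeasure (μ j) ∧ IsFiniteMeasure (μ' j)) → (∀ j : ℕ, j₀ ≤ j → j ≤ T → ((∀ U, PlaqSmall (θBal F.L γ b₀ p₀ j) U → 0 < ρ j U ∧ 0 < ρ' j U) ∧ μ j = (fieldMeasure _ _ _).withDensity (fun U => ENNReal.ofReal (ρ j U)) ∧ μ' j = (fieldMeasure _ _ _).withDensity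 (fun U => ENNReal.ofReal (ρ' j U)) ∧ (∃ κ : ℝ, MemAtHeight F ℰp j (prm j) (fun U => Real.exp κ * ρ j U)) ∧ (∃ κ : ℝ, MemAtHeight F ℰp j (prm j) (fun U => Real.exp κ * ρ' j U)) ∧ μ j {U | ¬ PlaqSmall (θBal F.L γ b₀ p₀ j) U} ≤ ENNReal.ofReal (η j) ∧ μ' j {U | ¬ PlaqSmall (θBal F.L γ b₀ p₀ j) U} ≤ ENNReal.ofReal (η j) ∧ (ContinuousOn (ρ j) {U | PlaqSmall (θBal F.L γ b₀ p₀ j) U} ∧ ContinuousOn (ρ' j) {U | PlaqSmall (θBal F.L γ b₀ p₀ j) U}))) → ∀ (j : ℕ), j₁ ≤ j → j + 2 ≤ T → j + 1 ≤ Ts → ∀ (c : Plaq (F.P (j + 1)) 0 → ℝ) (a w : ℝ), 0 ≤ a → 0 ≤ w → a + θ / (((F.L : ℝ) ^ (j + 1) / γ) * θBal F.L γ b₀ p₀ (j + 1) ^ 2) * w ≤ w₀ → ((∀ p, |c p| ≤ a) ∧ (∀ (b b' : PBond (F.P (j + 1)) 0) U V W Z, PlaqSmall (θBal F.L γ b₀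 p₀ (j + 1)) U → PlaqSmall (θBal F.L γ b₀ p₀ (j + 1)) V → PlaqSmall (θBal F.L γ b₀ p₀ (j + 1)) W → PlaqSmall (θBal F.L γ b₀ p₀ (j + 1)) Z → (∀ e, e ≠ b → U e = V e) → (∀ e, e ≠ b' → U e = W e) → (∀ e, e ≠ b' → V e = Z e) → (∀ e, e ≠ b → W e = Z e) → |(Real.log (ρ (j + 1) U) - Real.log (ρ' (j + 1) U) - ((F.L : ℝ) ^ (j + 1) / γ) * ∑ p, c p * (1 - reTr (GaugeField.plaqHol U p))) - (Real.log (ρ (j + 1) V) - Real.log (ρ' (j + 1) V) - ((F.L : ℝ) ^ (j + 1) / γ) * ∑ p, c p * (1 - reTr (GaugeField.plaqHol V p))) - ((Real.log (ρ (j + 1) W) - Real.log (ρ' (j + 1) W) - ((F.L : ℝ) ^ (j + 1) / γ) * ∑ p, c p * (1 - reTr (GaugeField.plaqHol W p))) - (Real.log (ρ (j + 1) Z) - Real.log (ρ' (j + 1) Z) - ((F.L : ℝ) ^ (j + 1) / γ) * ∑ p, c p * (1 - reTr (GaugeField.plaqHol Z p))))| ≤ w * Real.exp (-(κ * (b.src.tdist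 b'.src : ℝ))))) → ∃ (c' : Plaq (F.P j) 0 → ℝ) (a' w' : ℝ), 0 ≤ a' ∧ 0 ≤ w' ∧ a' + θ / (((F.L : ℝ) ^ j / γ) * θBal F.L γ b₀ p₀ j ^ 2) * w' ≤ (1 + ε j + εd (T - (j + 2)) + C * (a + θ / (((F.L : ℝ) ^ (j + 1) / γ) * θBal F.L γ b₀ p₀ (j + 1) ^ 2) * w)) * (a + θ / (((F.L : ℝ) ^ (j + 1) / γ) * θBal F.L γ b₀ p₀ (j + 1) ^ 2) * w) + δ j ∧ ((∀ p, |c' p| ≤ a') ∧ (∀ (b b' : PBond (F.P j) 0) U V W Z, PlaqSmall (θBal F.L γ b₀ p₀ j) U → PlaqSmall (θBal F.L γ b₀ p₀ j) V → PlaqSmall (θBal F.L γ b₀ p₀ j) W → PlaqSmall (θBal F.L γ b₀ p₀ j) Z → (∀ e, e ≠ b → U e = V e) → (∀ e, e ≠ b' → U e = W e) → (∀ e, e ≠ b' → V e = Z e) → (∀ e, e ≠ b → W e = Z e) → |(Real.log (ρ j U) - Real.log (ρ' j U) - ((F.L : ℝ) ^ j / γ) * ∑ p, c' p * (1 - reTr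 (GaugeField.plaqHol U p))) - (Real.log (ρ j V) - Real.log (ρ' j V) - ((F.L : ℝ) ^ j / γ) * ∑ p, c' p * (1 - reTr (GaugeField.plaqHol V p))) - ((Real.log (ρ j W) - Real.log (ρ' j W) - ((F.L : ℝ) ^ j / γ) * ∑ p, c' p * (1 - reTr (GaugeField.plaqHol W p))) - (Real.log (ρ j Z) - Real.log (ρ' j Z) - ((F.L : ℝ) ^ j / γ) * ∑ p, c' p * (1 - reTr (GaugeField.plaqHol Z p))))| ≤ w' * Real.exp (-(κ * (b.src.tdist b'.src : ℝ)))))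

/-- VER∘ (v2) · window-continuous version of the LOCALISED fibre mean `E′_χ[h | ·]` (g25-1 row 1 v2, restated BY TEXT, byte-identical with
`OrganTangent.FibreMeanVersionCan`; its stub lives in organ_tangent.lean). -/
def FibreMeanVersionCan : Prop :=
  ∀ (F : T3Family) (γ b₀ p₀ : ℝ), 0 < γ → γ ≤ 1 → 0 < b₀ → 0 < p₀ → ∃ jV : ℕ, ∀ (j₀ : ℕ) (prm : ℕ → ClassParams) (η : ℕ → ℝ), ∀ (ν : ℕ → (j : ℕ) → MeasureTheory.Measure (GaugeField (F.P j) 0 ↥(Matrix.specialUnitaryGroup (Fin 2) ℂ))), (∀ K, ν K K = T4GenFunBounds.gibbsMeasure (F.P K) ((F.scheme ℰp γ).β K)) → (∀ K j, j < K → ν K j = Measure.map (descend F ℰp j) (ν K (j + 1))) → ∀ (K K' : ℕ), K ≤ K' → ∀ (Ts T : ℕ), Ts < T → T ≤ K → ∀ (μ μ' : ((j : ℕ) → MeasureTheory.Measure (GaugeField (F.P j) 0 ↥(Matrix.specialUnitaryGroup (Fin 2) ℂ)))) (ρ ρ' : ((j : ℕ) → GaugeField (F.P j) 0 ↥(Matrix.specialUnitaryGroup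 (Fin 2) ℂ) → ℝ)), (∀ j : ℕ, Ts ≤ j → j ≤ T → μ j = ν K j ∧ μ' j = ν K' j) → (∀ j : ℕ, j < Ts → μ j = Measure.map (descend F ℰp j) ((μ (j + 1)).withDensity (fun U => ENNReal.ofReal (sfCut (θBal F.L γ b₀ p₀ (j + 1)) U))) ∧ μ' j = Measure.map (descend F ℰp j) ((μ' (j + 1)).withDensity (fun U => ENNReal.ofReal (sfCut (θBal F.L γ b₀ p₀ (j + 1)) U)))) → (∀ j : ℕ, Ts ≤ j → j < T → μ j = Measure.map (descend F ℰp j) (μ (j + 1)) ∧ μ' j = Measure.map (descend F ℰp j) (μ' (j + 1))) → (∀ j : ℕ, j ≤ T → IsFiniteMeasure (μ j) ∧ IsFiniteMeasure (μ' j)) → (∀ j : ℕ, j₀ ≤ j → j ≤ T → ((∀ U, PlaqSmall (θBal F.L γ b₀ p₀ j) U → 0 < ρ j U ∧ 0 < ρ' j U) ∧ μ j = (fieldMeasure _ _ _).withDensity (fun U => ENNReal.ofReal (ρ j U)) ∧ μ' j = (fieldMeasure _ _ _).withDensity (fun U => ENNReal.ofReal (ρ' j U)) ∧ (∃ κ :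 ℝ, MemAtHeight F ℰp j (prm j) (fun U => Real.exp κ * ρ j U)) ∧ (∃ κ : ℝ, MemAtHeight F ℰp j (prm j) (fun U => Real.exp κ * ρ' j U)) ∧ μ j {U | ¬ PlaqSmall (θBal F.L γ b₀ p₀ j) U} ≤ ENNReal.ofReal (η j) ∧ μ' j {U | ¬ PlaqSmall (θBal F.L γ b₀ p₀ j) U} ≤ ENNReal.ofReal (η j) ∧ (ContinuousOn (ρ j) {U | PlaqSmall (θBal F.L γ b₀ p₀ j) U} ∧ ContinuousOn (ρ' j) {U | PlaqSmall (θBal F.L γ b₀ p₀ j) U}))) → ∀ (j : ℕ), jV ≤ j → j₀ ≤ j → j + 1 ≤ T → ∀ (σ : ProbabilityTheory.Kernel (GaugeField (F.P j) 0 ↥(Matrix.specialUnitaryGroup (Fin 2) ℂ)) (GaugeField (F.P (j + 1)) 0 ↥(Matrix.specialUnitaryGroup (Fin 2) ℂ))), ProbabilityTheory.IsMarkovKernel σ → (Measure.map (descend F ℰp j) (fieldMeasure (F.P (j + 1)) 0 ↥(Matrix.specialUnitaryGroup (Fin 2) ℂ))).bind ⇑σ = fieldMeasure (F.P (j + 1))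 0 ↥(Matrix.specialUnitaryGroup (Fin 2) ℂ) → (∀ᵐ V ∂(Measure.map (descend F ℰp j) (fieldMeasure (F.P (j + 1)) 0 ↥(Matrix.specialUnitaryGroup (Fin 2) ℂ))), ∀ᵐ U ∂(σ V), descend F ℰp j U = V) → ∃ (m : GaugeField (F.P j) 0 ↥(Matrix.specialUnitaryGroup (Fin 2) ℂ) → ℝ), ContinuousOn m {V | PlaqSmall (θBal F.L γ b₀ p₀ j) V} ∧ (∀ᵐ V ∂(fieldMeasure (F.P j) 0 ↥(Matrix.specialUnitaryGroup (Fin 2) ℂ)), PlaqSmall (θBal F.L γ b₀ p₀ j) V → MeasureTheory.Integrable (fun U => sfCut (θBal F.L γ b₀ p₀ (j + 1)) U * (Real.log (ρ (j + 1) U) - Real.log (ρ' (j + 1) U)) * ρ' (j + 1) U) (σ V) ∧ m V = (∫ U, sfCut (θBal F.L γ b₀ p₀ (j + 1)) U * (Real.log (ρ (j + 1) U) - Real.log (ρ' (j + 1) U)) * ρ' (j + 1) U ∂(σ V)) / (∫ U, sfCut (θBal F.L γ b₀ p₀ (j + 1)) U * ρ' (j + 1) U ∂(σ V)))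

/-- LIN∘ · tangent transport (g25-1 row 2, restated BY TEXT, byte-identical with `OrganTangent.TangentTransportCan`) — the row CUT by
this line: DERIVED below from MIN∘ ∧ BGEV∘ ∧ FLUC∘ (`tangentTransport_of_classicalQuantum`), no stub here. -/
def TangentTransportCan : Prop :=
  ∃ γ₁ : ℝ, 0 < γ₁ ∧ ∀ (F : T3Family) (γ : ℝ), 0 < γ → γ ≤ γ₁ → ∀ (b₀ p₀ : ℝ) (j₀ : ℕ) (prm : ℕ → ClassParams) (η : ℕ → ℝ), 0 < b₀ → 0 < p₀ → AdmissibleClassParams F γ b₀ p₀ prm → (∀ j, 0 ≤ η j) → Summable η → Summable (fun i => ∑' k, η (k + i)) → Tendsto (fun j => (∑' k, η (k + j)) * ((1 + 2 * ((F.L : ℝ) ^ j / γ) * (Fintype.card (Plaq (F.P j) 0) : ℝ)) * (Fintype.card (PBond (F.P j) 0) : ℝ) ^ 2)) atTop (𝓝 0) → ∃ κ₀ : ℝ, 0 < κ₀ ∧ ∀ (κ : ℝ), 0 < κ → κ ≤ κ₀ → ∃ θ₀ : ℝ, 0 < θ₀ ∧ ∀ (θ : ℝ), 0 < θ → θ ≤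 θ₀ → ∃ (w₀ : ℝ) (ε εd δ : ℕ → ℝ) (j₁ : ℕ), 0 < w₀ ∧ (∀ j, 0 ≤ ε j ∧ 0 ≤ εd j ∧ 0 ≤ δ j) ∧ Summable ε ∧ Summable εd ∧ Summable δ ∧ Summable (fun i => ∑' k, δ (k + i)) ∧ Tendsto (fun j => (∑' k, δ (k + j)) * ((1 + 2 * ((F.L : ℝ) ^ j / γ) * (Fintype.card (Plaq (F.P j) 0) : ℝ)) * (Fintype.card (PBond (F.P j) 0) : ℝ) ^ 2)) atTop (𝓝 0) ∧ j₀ ≤ j₁ ∧ ∀ (ν : ℕ → (j : ℕ) → MeasureTheory.Measure (GaugeField (F.P j) 0 ↥(Matrix.specialUnitaryGroup (Fin 2) ℂ))), (∀ K, ν K K = T4GenFunBounds.gibbsMeasure (F.P K) ((F.scheme ℰp γ).β K)) → (∀ K j, j < K → ν K j = Measure.map (descend F ℰp j) (ν K (j + 1))) → ∀ (K K' : ℕ), K ≤ K' → ∀ (Ts T : ℕ), Ts < T → T ≤ K → ∀ (μ μ' : ((j : ℕ) → MeasureTheory.Measure (GaugeField (F.P j) 0 ↥(Matrix.specialUnitaryGroup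 (Fin 2) ℂ)))) (ρ ρ' : ((j : ℕ) → GaugeField (F.P j) 0 ↥(Matrix.specialUnitaryGroup (Fin 2) ℂ) → ℝ)), (∀ j : ℕ, Ts ≤ j → j ≤ T → μ j = ν K j ∧ μ' j = ν K' j) → (∀ j : ℕ, j < Ts → μ j = Measure.map (descend F ℰp j) ((μ (j + 1)).withDensity (fun U => ENNReal.ofReal (sfCut (θBal F.L γ b₀ p₀ (j + 1)) U))) ∧ μ' j = Measure.map (descend F ℰp j) ((μ' (j + 1)).withDensity (fun U => ENNReal.ofReal (sfCut (θBal F.L γ b₀ p₀ (j + 1)) U)))) → (∀ j : ℕ, Ts ≤ j → j < T → μ j = Measure.map (descend F ℰp j) (μ (j + 1)) ∧ μ' j = Measure.map (descend F ℰp j) (μ' (j + 1))) → (∀ j : ℕ, j ≤ T → IsFiniteMeasure (μ j) ∧ IsFiniteMeasure (μ' j)) → (∀ j : ℕ, j₀ ≤ j → j ≤ T → ((∀ U, PlaqSmall (θBal F.L γ b₀ p₀ j) U → 0 < ρ j U ∧ 0 < ρ' j U) ∧ μ j = (fieldMeasure _ _ _).withDensity (fun U => ENNReal.ofReal (ρ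 j U)) ∧ μ' j = (fieldMeasure _ _ _).withDensity (fun U => ENNReal.ofReal (ρ' j U)) ∧ (∃ κ : ℝ, MemAtHeight F ℰp j (prm j) (fun U => Real.exp κ * ρ j U)) ∧ (∃ κ : ℝ, MemAtHeight F ℰp j (prm j) (fun U => Real.exp κ * ρ' j U)) ∧ μ j {U | ¬ PlaqSmall (θBal F.L γ b₀ p₀ j) U} ≤ ENNReal.ofReal (η j) ∧ μ' j {U | ¬ PlaqSmall (θBal F.L γ b₀ p₀ j) U} ≤ ENNReal.ofReal (η j) ∧ (ContinuousOn (ρ j) {U | PlaqSmall (θBal F.L γ b₀ p₀ j) U} ∧ ContinuousOn (ρ' j) {U | PlaqSmall (θBal F.L γ b₀ p₀ j) U}))) → ∀ (j : ℕ), j₁ ≤ j → j + 2 ≤ T → j + 1 ≤ Ts → ∀ (σ : ProbabilityTheory.Kernel (GaugeField (F.P j) 0 ↥(Matrix.specialUnitaryGroup (Fin 2) ℂ)) (GaugeField (F.P (j + 1)) 0 ↥(Matrix.specialUnitaryGroup (Fin 2) ℂ))), ProbabilityTheory.IsMarkovKernel σ → (Measure.map (descend F ℰp j) (fieldMeasure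 (F.P (j + 1)) 0 ↥(Matrix.specialUnitaryGroup (Fin 2) ℂ))).bind ⇑σ = fieldMeasure (F.P (j + 1)) 0 ↥(Matrix.specialUnitaryGroup (Fin 2) ℂ) → (∀ᵐ V ∂(Measure.map (descend F ℰp j) (fieldMeasure (F.P (j + 1)) 0 ↥(Matrix.specialUnitaryGroup (Fin 2) ℂ))), ∀ᵐ U ∂(σ V), descend F ℰp j U = V) → ∀ (m : GaugeField (F.P j) 0 ↥(Matrix.specialUnitaryGroup (Fin 2) ℂ) → ℝ), ContinuousOn m {V | PlaqSmall (θBal F.L γ b₀ p₀ j) V} → (∀ᵐ V ∂(fieldMeasure (F.P j) 0 ↥(Matrix.specialUnitaryGroup (Fin 2) ℂ)), PlaqSmall (θBal F.L γ b₀ p₀ j) V → MeasureTheory.Integrable (fun U => sfCut (θBal F.L γ b₀ p₀ (j + 1)) U * (Real.log (ρ (j + 1) U) - Real.log (ρ' (j + 1) U)) * ρ' (j + 1) U) (σ V) ∧ m V = (∫ U, sfCut (θBal F.L γ b₀ p₀ (j + 1)) U * (Real.log (ρ (j + 1) U) - Real.log (ρ' (j + 1) U)) * ρ' (j + 1) U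 ∂(σ V)) / (∫ U, sfCut (θBal F.L γ b₀ p₀ (j + 1)) U * ρ' (j + 1) U ∂(σ V))) → ∀ (c : Plaq (F.P (j + 1)) 0 → ℝ) (a w : ℝ), 0 ≤ a → 0 ≤ w → a + θ / (((F.L : ℝ) ^ (j + 1) / γ) * θBal F.L γ b₀ p₀ (j + 1) ^ 2) * w ≤ w₀ → ((∀ p, |c p| ≤ a) ∧ (∀ (b b' : PBond (F.P (j + 1)) 0) U V W Z, PlaqSmall (θBal F.L γ b₀ p₀ (j + 1)) U → PlaqSmall (θBal F.L γ b₀ p₀ (j + 1)) V → PlaqSmall (θBal F.L γ b₀ p₀ (j + 1)) W → PlaqSmall (θBal F.L γ b₀ p₀ (j + 1)) Z → (∀ e, e ≠ b → U e = V e) → (∀ e, e ≠ b' → U e = W e) → (∀ e, e ≠ b' → V e = Z e) → (∀ e, e ≠ b → W e = Z e) → |(Real.log (ρ (j + 1) U) - Real.log (ρ' (j + 1) U) - ((F.L : ℝ) ^ (j + 1) / γ) * ∑ p, c p * (1 - reTr (GaugeField.plaqHol U p))) - (Real.log (ρ (j + 1) V) - Real.log (ρ' (j + 1) V) - ((F.L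 : ℝ) ^ (j + 1) / γ) * ∑ p, c p * (1 - reTr (GaugeField.plaqHol V p))) - ((Real.log (ρ (j + 1) W) - Real.log (ρ' (j + 1) W) - ((F.L : ℝ) ^ (j + 1) / γ) * ∑ p, c p * (1 - reTr (GaugeField.plaqHol W p))) - (Real.log (ρ (j + 1) Z) - Real.log (ρ' (j + 1) Z) - ((F.L : ℝ) ^ (j + 1) / γ) * ∑ p, c p * (1 - reTr (GaugeField.plaqHol Z p))))| ≤ w * Real.exp (-(κ * (b.src.tdist b'.src : ℝ))))) → ∃ (c' : Plaq (F.P j) 0 → ℝ) (a' w' : ℝ), 0 ≤ a' ∧ 0 ≤ w' ∧ a' + θ / (((F.L : ℝ) ^ j / γ) * θBal F.L γ b₀ p₀ j ^ 2) * w' ≤ (1 + ε j + εd (T - (j + 2))) * (a + θ / (((F.L : ℝ) ^ (j + 1) / γ) * θBal F.L γ b₀ p₀ (j + 1) ^ 2) * w) + δ j ∧ ((∀ p, |c' p| ≤ a') ∧ (∀ (b b' : PBond (F.P j) 0) U V W Z, PlaqSmall (θBal F.L γ b₀ p₀ j) U → PlaqSmall (θBal F.L γ b₀ p₀ j) V →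 PlaqSmall (θBal F.L γ b₀ p₀ j) W → PlaqSmall (θBal F.L γ b₀ p₀ j) Z → (∀ e, e ≠ b → U e = V e) → (∀ e, e ≠ b' → U e = W e) → (∀ e, e ≠ b' → V e = Z e) → (∀ e, e ≠ b → W e = Z e) → |(m U - ((F.L : ℝ) ^ j / γ) * ∑ p, c' p * (1 - reTr (GaugeField.plaqHol U p))) - (m V - ((F.L : ℝ) ^ j / γ) * ∑ p, c' p * (1 - reTr (GaugeField.plaqHol V p))) - ((m W - ((F.L : ℝ) ^ j / γ) * ∑ p, c' p * (1 - reTr (GaugeField.plaqHol W p))) - (m Z - ((F.L : ℝ) ^ j / γ) * ∑ p, c' p * (1 - reTr (GaugeField.plaqHol Z p))))| ≤ w' * Real.exp (-(κ * (b.src.tdist b'.src : ℝ)))))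

/-- JEN∘ · Jensen gap (g25-1 row 3, restated BY TEXT, byte-identical with `OrganTangent.JensenGapCan`; stub in organ_tangent.lean). -/
def JensenGapCan : Prop :=
  ∃ γ₁ : ℝ, 0 < γ₁ ∧ ∀ (F : T3Family) (γ : ℝ), 0 < γ → γ ≤ γ₁ → ∀ (b₀ p₀ : ℝ) (j₀ : ℕ) (prm : ℕ → ClassParams) (η : ℕ → ℝ), 0 < b₀ → 0 < p₀ → AdmissibleClassParams F γ b₀ p₀ prm → (∀ j, 0 ≤ η j) → Summable η → Summable (fun i => ∑' k, η (k + i)) → Tendsto (fun j => (∑' k, η (k + j)) * ((1 + 2 * ((F.L : ℝ) ^ j / γ) * (Fintype.card (Plaq (F.P j) 0) : ℝ)) * (Fintype.card (PBond (F.P j) 0) : ℝ) ^ 2)) atTop (𝓝 0) → ∃ κ₀ : ℝ, 0 < κ₀ ∧ ∀ (κ : ℝ), 0 < κ → κ ≤ κ₀ → ∃ θ₀ : ℝ, 0 < θ₀ ∧ ∀ (θ : ℝ), 0 < θ → θ ≤ θ₀ → ∃ (C w₀ : ℝ) (δ : ℕ → ℝ) (j₁ : ℕ), 0 ≤ C ∧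 0 < w₀ ∧ (∀ j, 0 ≤ δ j) ∧ Summable δ ∧ Summable (fun i => ∑' k, δ (k + i)) ∧ Tendsto (fun j => (∑' k, δ (k + j)) * ((1 + 2 * ((F.L : ℝ) ^ j / γ) * (Fintype.card (Plaq (F.P j) 0) : ℝ)) * (Fintype.card (PBond (F.P j) 0) : ℝ) ^ 2)) atTop (𝓝 0) ∧ j₀ ≤ j₁ ∧ ∀ (ν : ℕ → (j : ℕ) → MeasureTheory.Measure (GaugeField (F.P j) 0 ↥(Matrix.specialUnitaryGroup (Fin 2) ℂ))), (∀ K, ν K K = T4GenFunBounds.gibbsMeasure (F.P K) ((F.scheme ℰp γ).β K)) → (∀ K j, j < K → ν K j = Measure.map (descend F ℰp j) (ν K (j + 1))) → ∀ (K K' : ℕ), K ≤ K' → ∀ (Ts T : ℕ), Ts < T → T ≤ K → ∀ (μ μ' : ((j : ℕ) → MeasureTheory.Measure (GaugeField (F.P j) 0 ↥(Matrix.specialUnitaryGroup (Fin 2) ℂ)))) (ρ ρ' : ((j : ℕ) → GaugeField (F.P j) 0 ↥(Matrix.specialUnitaryGroup (Fin 2) ℂ) → ℝ)), (∀ j : ℕ,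 Ts ≤ j → j ≤ T → μ j = ν K j ∧ μ' j = ν K' j) → (∀ j : ℕ, j < Ts → μ j = Measure.map (descend F ℰp j) ((μ (j + 1)).withDensity (fun U => ENNReal.ofReal (sfCut (θBal F.L γ b₀ p₀ (j + 1)) U))) ∧ μ' j = Measure.map (descend F ℰp j) ((μ' (j + 1)).withDensity (fun U => ENNReal.ofReal (sfCut (θBal F.L γ b₀ p₀ (j + 1)) U)))) → (∀ j : ℕ, Ts ≤ j → j < T → μ j = Measure.map (descend F ℰp j) (μ (j + 1)) ∧ μ' j = Measure.map (descend F ℰp j) (μ' (j + 1))) → (∀ j : ℕ, j ≤ T → IsFiniteMeasure (μ j) ∧ IsFiniteMeasure (μ' j)) → (∀ j : ℕ, j₀ ≤ j → j ≤ T → ((∀ U, PlaqSmall (θBal F.L γ b₀ p₀ j) U → 0 < ρ j U ∧ 0 < ρ' j U) ∧ μ j = (fieldMeasure _ _ _).withDensity (fun U => ENNReal.ofReal (ρ j U)) ∧ μ' j = (fieldMeasure _ _ _).withDensity (fun U => ENNReal.ofReal (ρ' j U)) ∧ (∃ κ : ℝ, MemAtHeight F ℰp j (prm j) (fun U => Real.exp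 κ * ρ j U)) ∧ (∃ κ : ℝ, MemAtHeight F ℰp j (prm j) (fun U => Real.exp κ * ρ' j U)) ∧ μ j {U | ¬ PlaqSmall (θBal F.L γ b₀ p₀ j) U} ≤ ENNReal.ofReal (η j) ∧ μ' j {U | ¬ PlaqSmall (θBal F.L γ b₀ p₀ j) U} ≤ ENNReal.ofReal (η j) ∧ (ContinuousOn (ρ j) {U | PlaqSmall (θBal F.L γ b₀ p₀ j) U} ∧ ContinuousOn (ρ' j) {U | PlaqSmall (θBal F.L γ b₀ p₀ j) U}))) → ∀ (j : ℕ), j₁ ≤ j → j + 2 ≤ T → j + 1 ≤ Ts → ∀ (σ : ProbabilityTheory.Kernel (GaugeField (F.P j) 0 ↥(Matrix.specialUnitaryGroup (Fin 2) ℂ)) (GaugeField (F.P (j + 1)) 0 ↥(Matrix.specialUnitaryGroup (Fin 2) ℂ))), ProbabilityTheory.IsMarkovKernel σ → (Measure.map (descend F ℰp j) (fieldMeasure (F.P (j + 1)) 0 ↥(Matrix.specialUnitaryGroup (Fin 2) ℂ))).bind ⇑σ = fieldMeasure (F.P (j + 1)) 0 ↥(Matrix.specialUnitaryGroup (Fin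 2) ℂ) → (∀ᵐ V ∂(Measure.map (descend F ℰp j) (fieldMeasure (F.P (j + 1)) 0 ↥(Matrix.specialUnitaryGroup (Fin 2) ℂ))), ∀ᵐ U ∂(σ V), descend F ℰp j U = V) → ∀ (m : GaugeField (F.P j) 0 ↥(Matrix.specialUnitaryGroup (Fin 2) ℂ) → ℝ), ContinuousOn m {V | PlaqSmall (θBal F.L γ b₀ p₀ j) V} → (∀ᵐ V ∂(fieldMeasure (F.P j) 0 ↥(Matrix.specialUnitaryGroup (Fin 2) ℂ)), PlaqSmall (θBal F.L γ b₀ p₀ j) V → MeasureTheory.Integrable (fun U => sfCut (θBal F.L γ b₀ p₀ (j + 1)) U * (Real.log (ρ (j + 1) U) - Real.log (ρ' (j + 1) U)) * ρ' (j + 1) U) (σ V) ∧ m V = (∫ U, sfCut (θBal F.L γ b₀ p₀ (j + 1)) U * (Real.log (ρ (j + 1) U) - Real.log (ρ' (j + 1) U)) * ρ' (j + 1) U ∂(σ V)) / (∫ U, sfCut (θBal F.L γ b₀ p₀ (j + 1)) U * ρ' (j + 1) U ∂(σ V))) → ∀ (c : Plaq (F.P (j + 1)) 0 → ℝ) (a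 w : ℝ), 0 ≤ a → 0 ≤ w → a + θ / (((F.L : ℝ) ^ (j + 1) / γ) * θBal F.L γ b₀ p₀ (j + 1) ^ 2) * w ≤ w₀ → ((∀ p, |c p| ≤ a) ∧ (∀ (b b' : PBond (F.P (j + 1)) 0) U V W Z, PlaqSmall (θBal F.L γ b₀ p₀ (j + 1)) U → PlaqSmall (θBal F.L γ b₀ p₀ (j + 1)) V → PlaqSmall (θBal F.L γ b₀ p₀ (j + 1)) W → PlaqSmall (θBal F.L γ b₀ p₀ (j + 1)) Z → (∀ e, e ≠ b → U e = V e) → (∀ e, e ≠ b' → U e = W e) → (∀ e, e ≠ b' → V e = Z e) → (∀ e, e ≠ b → W e = Z e) → |(Real.log (ρ (j + 1) U) - Real.log (ρ' (j + 1) U) - ((F.L : ℝ) ^ (j + 1) / γ) * ∑ p, c p * (1 - reTr (GaugeField.plaqHol U p))) - (Real.log (ρ (j + 1) V) - Real.log (ρ' (j + 1) V) - ((F.L : ℝ) ^ (j + 1) / γ) * ∑ p, c p * (1 - reTr (GaugeField.plaqHol V p))) - ((Real.log (ρ (j + 1) W) - Real.log (ρ' (j + 1) W) - ((F.L : ℝ)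 ^ (j + 1) / γ) * ∑ p, c p * (1 - reTr (GaugeField.plaqHol W p))) - (Real.log (ρ (j + 1) Z) - Real.log (ρ' (j + 1) Z) - ((F.L : ℝ) ^ (j + 1) / γ) * ∑ p, c p * (1 - reTr (GaugeField.plaqHol Z p))))| ≤ w * Real.exp (-(κ * (b.src.tdist b'.src : ℝ))))) → ∃ (w' : ℝ), 0 ≤ w' ∧ θ / (((F.L : ℝ) ^ j / γ) * θBal F.L γ b₀ p₀ j ^ 2) * w' ≤ C * (a + θ / (((F.L : ℝ) ^ (j + 1) / γ) * θBal F.L γ b₀ p₀ (j + 1) ^ 2) * w) * (a + θ / (((F.L : ℝ) ^ (j + 1) / γ) * θBal F.L γ b₀ p₀ (j + 1) ^ 2) * w) + δ j ∧ (∀ (b b' : PBond (F.P j) 0) U V W Z, PlaqSmall (θBal F.L γ b₀ p₀ j) U → PlaqSmall (θBal F.L γ b₀ p₀ j) V → PlaqSmall (θBal F.L γ b₀ p₀ j) W → PlaqSmall (θBal F.L γ b₀ p₀ j) Z → (∀ e, e ≠ b → U e = V e) → (∀ e, e ≠ b' → U e = W e) → (∀ e, e ≠ b' → V e = Z e) →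 (∀ e, e ≠ b → W e = Z e) → |(Real.log (ρ j U) - Real.log (ρ' j U) - m U) - (Real.log (ρ j V) - Real.log (ρ' j V) - m V) - ((Real.log (ρ j W) - Real.log (ρ' j W) - m W) - (Real.log (ρ j Z) - Real.log (ρ' j Z) - m Z))| ≤ w' * Real.exp (-(κ * (b.src.tdist b'.src : ℝ))))

/-- MIN∘ · A CONTINUOUS CONSTRAINED-MINIMISER SECTION ON THE WINDOW (row 1 of this line; size M–L, variational).  For the family's
averaging `descend F ℰp j : T_{j+1} → T_j` and every `γ ∈ (0,1]`, `b₀, p₀ > 0`, from some height `j₁` on there is a map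
`U⋆ : T_j → T_{j+1}`, continuous on the coarse Bałaban window `{PlaqSmall θBal_j}`, with, for every window datum `V`:
`descend (U⋆ V) = V`, `U⋆ V` in the FINE window `{PlaqSmall θBal_{j+1}}`, and `A(U⋆ V) ≤ A(U)` for every fine-window `U` over `V`
(`A = wilsonAction4`).  Mechanism: [Balaban1985Variational] Thm 1 — existence of the minimal orbit of the Wilson action over the regular
part of the constraint space, with plaquette variables `O(L⁻²·datum)` ((8)–(10)) and analytic dependence on the datum (his Sect. on
the background field as a function of `V`).  v2 (idea-crit-5 #515 (ii)(b)): `U⋆` IS Bałaban's minimiser as an explicit FUNCTION `U(V)` of the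
datum — the contraction fixed point in block-axial gauge of [Balaban1985Variational] (his construction of the background field), covariant
under coarse gauge transformations — NOT a choice from the minimal orbit: no selection theorem, no global gauge is wanted.
Why it might fail: the competitor set is the OPEN fine window, so the row needs the minimiser over its closure to have plaquettes
`< θBal_{j+1}` strictly — i.e. the spreading constant `C_spr` of the harmonic extension must satisfy `C_spr·θBal_j/L² < θBal_{j+1}`
(`θBal_{j+1}/θBal_j ≍ L^{-1/2}`: fine for `L ≥ 2` unless `C_spr > L^{3/2}`); a continuous GLOBAL section on the torus window (which contains
all plaquette-small, holonomy-nontrivial data) needs the covariant construction, not a global gauge; uniqueness is NOT claimed (BGEV∘/FLUC∘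
quantify over every such section).  Sources: [Balaban1985Variational] Thm 1, (8)–(10) p.279, Prop. 9; tree `T3ConstrainedMinimiser.minAction`,
`T3MinimiserStabilityReduction.HasMinimisersAt` (the multi-step existence schema, never asserted). -/
def MinimiserSectionCan : Prop :=
  ∀ (F : T3Family) (γ b₀ p₀ : ℝ), 0 < γ → γ ≤ 1 → 0 < b₀ → 0 < p₀ → ∃ j₁ : ℕ, ∀ (j : ℕ), j₁ ≤ j → ∃ (Us : GaugeField (F.P j) 0 ↥(Matrix.specialUnitaryGroup (Fin 2) ℂ) → GaugeField (F.P (j + 1)) 0 ↥(Matrix.specialUnitaryGroup (Fin 2) ℂ)), ContinuousOn Us {V | PlaqSmall (θBal F.L γ b₀ p₀ j) V} ∧ (∀ V, PlaqSmall (θBal F.L γ b₀ p₀ j) V → descend F ℰp j (Us V) = V ∧ PlaqSmall (θBal F.L γ b₀ p₀ (j + 1)) (Us V) ∧ ∀ U, descend F ℰp j U = V → PlaqSmall (θBal F.L γ b₀ p₀ (j + 1)) U → wilsonAction4 (Us V) ≤ wilsonAction4 U)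

/-- BGEV∘ · CLASSICAL TRANSPORT THROUGH THE MINIMISER SECTION (row 2 of this line; size L — the HARDEST; variational + KT-W).  In LIN∘'s
frame (O1's tower block verbatim; «∀ θ ∈ (0, θ₀]» head; profiles `ε` (classical anharmonic correction, `O(θBal_j²)`), `εd` (equilibration
defect in the depth `n = T − (j+2)`), floor `δ` of O1's class, smallness `w₀`), for EVERY section `U⋆` with MIN∘'s four properties and every
input presentation `(c, a, w)` of `h = log ρ_{j+1} − log ρ′_{j+1}` with `x ≤ w₀`: the CLASSICAL RESTRICTION `V ↦ h(U⋆ V)` has a coarse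
presentation `(c⋆, a⋆, w⋆)`, `|c⋆_P| ≤ a⋆`, with `a⋆ + Θ_j w⋆ ≤ (1 + ε_j + εd_n)·x + δ_j` and the 4-point clause at height `j`, for
`κ ∈ (0, κ₀]` (O1-R1: `κ₀` = the classical response rate `κ_cl(L)` of the minimiser, chosen before the towers).  No measure,
no fibre law enters the conclusion.  Mechanism: marginal channel `β_{j+1}Σ_p c_p(1 − Re tr(U⋆V)_p) = β_jΣ_P c⋆_P(1 − Re tr V_P) + spreading`,
`c⋆_P =` block average of `c` (so `|c⋆| ≤ a`), spreading = quasi-local off-diagonal quadratic form in the coarse curvature whose size in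
marginal units is the KT-W constant `κ_geom·θ` for a Wilson-exact input and `εd_n·x` for a depth-`n` equilibrated one (classically perfect
action recursion, arXiv:hep-lat/9506030 §3–§4); remainder channel: pull-back of the fine 4-point clause along `U⋆`, telescoped over fine bonds
with the exponential response decay of the minimiser ([Balaban1985Variational] Prop. 9), the `L³` bond count per block paid by
`Θ_j/Θ_{j+1} = p(g_{j+1})²/(L·p(g_j)²)`-bookkeeping inside `(1 + ε_j)`.
Why it might fail: (i) THE KT-W BET, now isolated here: class membership of both towers at heights `j+2 … T` must force their discrepancy at
`j+1` to be depth-`n` EQUILIBRATED so that the classical spreading defect is `εd_n` with `Σ εd_n < ∞` (instrument F2: a Wilson-exact input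
returns `x′/x = 1 + κ_geom·θ`); (ii) the remainder pull-back constant must be `≤ 1 + ε_j` in marginal units uniformly on the window — a
response sum `Σ_e |∂(U⋆)_e/∂V_b|` of order `L³` against the gain `L·p(g_j)²/p(g_{j+1})² ≍ L` leaves NO room unless the decay of the input's
4-point clause (`e^{−κ d}` at the FINE scale, `d` = fine torus distance) contracts to the coarse `e^{−κ d}` with a factor `≤ 1/L²` — true for
`κ`-clustered inputs only if `κ·L ≥ κ + 2 log L`-type room exists; v2/O1-R1 caps `κ ≤ κ₀ = κ_cl(L)` (the minimiser's response rate,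
[Balaban1985Variational] (190)), so the pull-back never has to beat the minimiser's own decay, but the shared `κ` at both heights still
under-uses the fine-scale clustering (instrument FL-17 (2b) prints the worst-case pull-back norm `N(κ)`); (iii) non-unique minimising
orbits would make some sections jump.  Sources: [Balaban1985Variational] Thm 1, Prop. 9; [Balaban1987RG1] (0.22)–(0.30), Thm 1; arXiv:hep-lat/9506030 §3–§4
(classically perfect FP action, quadratic recursion, connecting tensor `Z`); doi:10.1016/0550-3213(94)90261-5 (Hasenfratz–Niedermayer 1994). -/
def ClassicalTransportCan : Prop :=
  ∃ γ₁ : ℝ, 0 < γ₁ ∧ ∀ (F : T3Family) (γ : ℝ), 0 < γ → γ ≤ γ₁ → ∀ (b₀ p₀ : ℝ) (j₀ : ℕ) (prm : ℕ → ClassParams) (η : ℕ → ℝ), 0 < b₀ → 0 < p₀ → AdmissibleClassParams F γ b₀ p₀ prm → (∀ j, 0 ≤ η j) → Summable η → Summable (fun i => ∑' k, η (k + i)) → Tendsto (fun j => (∑' k, η (k + j)) * ((1 + 2 * ((F.L : ℝ) ^ j / γ) * (Fintype.card (Plaq (F.P j) 0) : ℝ)) * (Fintype.card (PBond (F.P j)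 0) : ℝ) ^ 2)) atTop (𝓝 0) → ∃ κ₀ : ℝ, 0 < κ₀ ∧ ∀ (κ : ℝ), 0 < κ → κ ≤ κ₀ → ∃ θ₀ : ℝ, 0 < θ₀ ∧ ∀ (θ : ℝ), 0 < θ → θ ≤ θ₀ → ∃ (w₀ : ℝ) (ε εd δ : ℕ → ℝ) (j₁ : ℕ), 0 < w₀ ∧ (∀ j, 0 ≤ ε j ∧ 0 ≤ εd j ∧ 0 ≤ δ j) ∧ Summable ε ∧ Summable εd ∧ Summable δ ∧ Summable (fun i => ∑' k, δ (k + i)) ∧ Tendsto (fun j => (∑' k, δ (k + j)) * ((1 + 2 * ((F.L : ℝ) ^ j / γ) * (Fintype.card (Plaq (F.P j) 0) : ℝ)) * (Fintype.card (PBond (F.P j) 0) : ℝ) ^ 2)) atTop (𝓝 0) ∧ j₀ ≤ j₁ ∧ ∀ (ν : ℕ → (j : ℕ) → MeasureTheory.Measure (GaugeField (F.P j) 0 ↥(Matrix.specialUnitaryGroup (Fin 2) ℂ))), (∀ K, ν K K = T4GenFunBounds.gibbsMeasure (F.P K) ((F.scheme ℰp γ).β K)) → (∀ K j, j < K → ν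 K j = Measure.map (descend F ℰp j) (ν K (j + 1))) → ∀ (K K' : ℕ), K ≤ K' → ∀ (Ts T : ℕ), Ts < T → T ≤ K → ∀ (μ μ' : ((j : ℕ) → MeasureTheory.Measure (GaugeField (F.P j) 0 ↥(Matrix.specialUnitaryGroup (Fin 2) ℂ)))) (ρ ρ' : ((j : ℕ) → GaugeField (F.P j) 0 ↥(Matrix.specialUnitaryGroup (Fin 2) ℂ) → ℝ)), (∀ j : ℕ, Ts ≤ j → j ≤ T → μ j = ν K j ∧ μ' j = ν K' j) → (∀ j : ℕ, j < Ts → μ j = Measure.map (descend F ℰp j) ((μ (j + 1)).withDensity (fun U => ENNReal.ofReal (sfCut (θBal F.L γ b₀ p₀ (j + 1)) U))) ∧ μ' j = Measure.map (descend F ℰp j) ((μ' (j + 1)).withDensity (fun U => ENNReal.ofReal (sfCut (θBal F.L γ b₀ p₀ (j + 1)) U)))) → (∀ j : ℕ, Ts ≤ j → j < T → μ j = Measure.map (descend F ℰp j) (μ (j + 1)) ∧ μ' j = Measure.map (descend F ℰp j) (μ' (j + 1))) → (∀ j : ℕ, j ≤ T → IsFiniteMeasure (μ j) ∧ IsFiniteMeasure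 (μ' j)) → (∀ j : ℕ, j₀ ≤ j → j ≤ T → ((∀ U, PlaqSmall (θBal F.L γ b₀ p₀ j) U → 0 < ρ j U ∧ 0 < ρ' j U) ∧ μ j = (fieldMeasure _ _ _).withDensity (fun U => ENNReal.ofReal (ρ j U)) ∧ μ' j = (fieldMeasure _ _ _).withDensity (fun U => ENNReal.ofReal (ρ' j U)) ∧ (∃ κ : ℝ, MemAtHeight F ℰp j (prm j) (fun U => Real.exp κ * ρ j U)) ∧ (∃ κ : ℝ, MemAtHeight F ℰp j (prm j) (fun U => Real.exp κ * ρ' j U)) ∧ μ j {U | ¬ PlaqSmall (θBal F.L γ b₀ p₀ j) U} ≤ ENNReal.ofReal (η j) ∧ μ' j {U | ¬ PlaqSmall (θBal F.L γ b₀ p₀ j) U} ≤ ENNReal.ofReal (η j) ∧ (ContinuousOn (ρ j) {U | PlaqSmall (θBal F.L γ b₀ p₀ j) U} ∧ ContinuousOn (ρ' j) {U | PlaqSmall (θBal F.L γ b₀ p₀ j) U}))) → ∀ (j : ℕ), j₁ ≤ j → j + 2 ≤ T → j + 1 ≤ Ts → ∀ (Us : GaugeField (F.P j) 0 ↥(Matrix.specialUnitaryGroup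 (Fin 2) ℂ) → GaugeField (F.P (j + 1)) 0 ↥(Matrix.specialUnitaryGroup (Fin 2) ℂ)), ContinuousOn Us {V | PlaqSmall (θBal F.L γ b₀ p₀ j) V} → (∀ V, PlaqSmall (θBal F.L γ b₀ p₀ j) V → descend F ℰp j (Us V) = V ∧ PlaqSmall (θBal F.L γ b₀ p₀ (j + 1)) (Us V) ∧ ∀ U, descend F ℰp j U = V → PlaqSmall (θBal F.L γ b₀ p₀ (j + 1)) U → wilsonAction4 (Us V) ≤ wilsonAction4 U) → ∀ (c : Plaq (F.P (j + 1)) 0 → ℝ) (a w : ℝ), 0 ≤ a → 0 ≤ w → a + θ / (((F.L : ℝ) ^ (j + 1) / γ) * θBal F.L γ b₀ p₀ (j + 1) ^ 2) * w ≤ w₀ → ((∀ p, |c p| ≤ a) ∧ (∀ (b b' : PBond (F.P (j + 1)) 0) U V W Z, PlaqSmall (θBal F.L γ b₀ p₀ (j + 1)) U → PlaqSmall (θBal F.L γ b₀ p₀ (j + 1)) V → PlaqSmall (θBal F.L γ b₀ p₀ (j + 1)) W → PlaqSmall (θBal F.L γ b₀ p₀ (j + 1)) Z → (∀ e, e ≠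 b → U e = V e) → (∀ e, e ≠ b' → U e = W e) → (∀ e, e ≠ b' → V e = Z e) → (∀ e, e ≠ b → W e = Z e) → |(Real.log (ρ (j + 1) U) - Real.log (ρ' (j + 1) U) - ((F.L : ℝ) ^ (j + 1) / γ) * ∑ p, c p * (1 - reTr (GaugeField.plaqHol U p))) - (Real.log (ρ (j + 1) V) - Real.log (ρ' (j + 1) V) - ((F.L : ℝ) ^ (j + 1) / γ) * ∑ p, c p * (1 - reTr (GaugeField.plaqHol V p))) - ((Real.log (ρ (j + 1) W) - Real.log (ρ' (j + 1) W) - ((F.L : ℝ) ^ (j + 1) / γ) * ∑ p, c p * (1 - reTr (GaugeField.plaqHol W p))) - (Real.log (ρ (j + 1) Z) - Real.log (ρ' (j + 1) Z) - ((F.L : ℝ) ^ (j + 1) / γ) * ∑ p, c p * (1 - reTr (GaugeField.plaqHol Z p))))| ≤ w * Real.exp (-(κ * (b.src.tdist b'.src : ℝ))))) → ∃ (c' : Plaq (F.P j) 0 → ℝ) (a' w' : ℝ), 0 ≤ a' ∧ 0 ≤ w' ∧ a' + θ / (((F.L : ℝ) ^ j / γ) * θBal F.L γ b₀ p₀ j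 ^ 2) * w' ≤ (1 + ε j + εd (T - (j + 2))) * (a + θ / (((F.L : ℝ) ^ (j + 1) / γ) * θBal F.L γ b₀ p₀ (j + 1) ^ 2) * w) + δ j ∧ ((∀ p, |c' p| ≤ a') ∧ (∀ (b b' : PBond (F.P j) 0) U V W Z, PlaqSmall (θBal F.L γ b₀ p₀ j) U → PlaqSmall (θBal F.L γ b₀ p₀ j) V → PlaqSmall (θBal F.L γ b₀ p₀ j) W → PlaqSmall (θBal F.L γ b₀ p₀ j) Z → (∀ e, e ≠ b → U e = V e) → (∀ e, e ≠ b' → U e = W e) → (∀ e, e ≠ b' → V e = Z e) → (∀ e, e ≠ b → W e = Z e) → |(Real.log (ρ (j + 1) (Us U)) - Real.log (ρ' (j + 1) (Us U)) - ((F.L : ℝ) ^ j / γ) * ∑ p, c' p * (1 - reTr (GaugeField.plaqHol U p))) - (Real.log (ρ (j + 1) (Us V)) - Real.log (ρ' (j + 1) (Us V)) - ((F.L : ℝ) ^ j / γ) * ∑ p, c' p * (1 - reTr (GaugeField.plaqHol V p))) - ((Real.log (ρ (j + 1) (Us W)) - Real.log (ρ' (j + 1) (Us W)) - ((F.L : ℝ)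 ^ j / γ) * ∑ p, c' p * (1 - reTr (GaugeField.plaqHol W p))) - (Real.log (ρ (j + 1) (Us Z)) - Real.log (ρ' (j + 1) (Us Z)) - ((F.L : ℝ) ^ j / γ) * ∑ p, c' p * (1 - reTr (GaugeField.plaqHol Z p))))| ≤ w' * Real.exp (-(κ * (b.src.tdist b'.src : ℝ)))))

/-- FLUC∘ · THE FLUCTUATION (QUANTUM) CORRECTION IS `ε`-SMALL (row 3 of this line; size L — one loop + cumulants on the small-field fibre).
In LIN∘'s frame with VER∘'s objects (`σ` a disintegration of product Haar along `descend`, `m` a window-continuous version of the LOCALISED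
reference fibre mean `E′_χ[h | ·]`, v2) and a section `U⋆` with MIN∘'s properties: the difference `V ↦ m(V) − h(U⋆ V)` has a coarse presentation
`(c″, a″, w″)`, `|c″| ≤ a″`, with `a″ + Θ_j w″ ≤ ε_j·x + δ_j` — NO order-one multiple of `x`; for `κ ∈ (0, κ₀]` (O1-R1).  Mechanism:
`m(V) − h(U⋆V) = E′_χ[h(U) − h(U⋆V) | descend U = V]` (`χ(U⋆V) = 1`: the minimiser's fine defects are `< θ_{j+1}/2`);
expanding around the background, the first-order term `⟨∇h(U⋆V), E′[ζ | V]⟩` vanishes for the marginal direction (constrained critical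
point: `∇A ⊥` fibre tangent space) and is `O(g_{j+1})·x` for remainders (quantum shift of the background `= O(g²p)` in lattice units against
`∇r = O(w/θBal)`); the second-order term `½ tr(G_V ∇²h)` is a `V`-independent constant for `h ∝ A_{j+1}` at one loop (instrument F1) and its
`V`-dependence — fibre-curvature of the constraint, `V`-dependence of the fluctuation covariance `G_V` ([Balaban1985Propagators]), third
cumulants — is `O(g_j²/θ)·a` on the marginal channel and `O(1/(L³p(g_j)²))·Θ_{j+1}w` on clustered remainders; large fields go to the floor.
Why it might fail: the remainder part of `ε_j` decays only like `1/p(g_j)² ∝ 1/j²` (summable, not geometric) and its constant must be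
window-uniform in `j`; beyond one loop the reference tower's own non-Gaussian corrections (`E`-terms of the class) pair with `h` at relative
size `O(g_j²)` only if the class's bounds control TWO derivatives of `log ρ′_{j+1}` along the fibre on the small-field set (Mem is
inequality-level: honest members yes; v2's cutoff `χ` keeps every integral on `{PlaqSmall θ_{j+1}}`, where the class speaks, and the collar ∕
large-field part of the fibre goes to the floor).  Sources: [Balaban1987RG1] §2, Thm 1;
[Balaban1988RG2] §1; [Balaban1985Propagators]; [Balaban1989LargeFieldII] §1 (floor); arXiv:2307.07619 §3.4 (fluctuation-measure expectation
as first variation, nearest analytic prior art). -/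
def FluctuationCorrectionCan : Prop :=
  ∃ γ₁ : ℝ, 0 < γ₁ ∧ ∀ (F : T3Family) (γ : ℝ), 0 < γ → γ ≤ γ₁ → ∀ (b₀ p₀ : ℝ) (j₀ : ℕ) (prm : ℕ → ClassParams) (η : ℕ → ℝ), 0 < b₀ → 0 < p₀ → AdmissibleClassParams F γ b₀ p₀ prm → (∀ j, 0 ≤ η j) → Summable η → Summable (fun i => ∑' k, η (k + i)) → Tendsto (fun j => (∑' k, η (k + j)) * ((1 + 2 * ((F.L : ℝ) ^ j / γ) * (Fintype.card (Plaq (F.P j) 0) : ℝ)) * (Fintype.card (PBond (F.P j) 0) : ℝ) ^ 2)) atTop (𝓝 0) → ∃ κ₀ : ℝ, 0 < κ₀ ∧ ∀ (κ : ℝ), 0 < κ → κ ≤ κ₀ → ∃ θ₀ : ℝ, 0 < θ₀ ∧ ∀ (θ : ℝ), 0 < θ → θ ≤ θ₀ → ∃ (w₀ : ℝ) (ε δ : ℕ → ℝ) (j₁ : ℕ), 0 < w₀ ∧ (∀ j, 0 ≤ ε j ∧ 0 ≤ δ j) ∧ Summable ε ∧ Summable δ ∧ Summable (fun i => ∑'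 k, δ (k + i)) ∧ Tendsto (fun j => (∑' k, δ (k + j)) * ((1 + 2 * ((F.L : ℝ) ^ j / γ) * (Fintype.card (Plaq (F.P j) 0) : ℝ)) * (Fintype.card (PBond (F.P j) 0) : ℝ) ^ 2)) atTop (𝓝 0) ∧ j₀ ≤ j₁ ∧ ∀ (ν : ℕ → (j : ℕ) → MeasureTheory.Measure (GaugeField (F.P j) 0 ↥(Matrix.specialUnitaryGroup (Fin 2) ℂ))), (∀ K, ν K K = T4GenFunBounds.gibbsMeasure (F.P K) ((F.scheme ℰp γ).β K)) → (∀ K j, j < K → ν K j = Measure.map (descend F ℰp j) (ν K (j + 1))) → ∀ (K K' : ℕ), K ≤ K' → ∀ (Ts T : ℕ), Ts < T → T ≤ K → ∀ (μ μ' : ((j : ℕ) → MeasureTheory.Measure (GaugeField (F.P j) 0 ↥(Matrix.specialUnitaryGroup (Fin 2) ℂ)))) (ρ ρ' : ((j : ℕ) → GaugeField (F.P j) 0 ↥(Matrix.specialUnitaryGroup (Fin 2) ℂ) → ℝ)), (∀ j : ℕ, Ts ≤ j → j ≤ T → μ j = ν K j ∧ μ' j = ν K' j) → (∀ j : ℕ,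 j < Ts → μ j = Measure.map (descend F ℰp j) ((μ (j + 1)).withDensity (fun U => ENNReal.ofReal (sfCut (θBal F.L γ b₀ p₀ (j + 1)) U))) ∧ μ' j = Measure.map (descend F ℰp j) ((μ' (j + 1)).withDensity (fun U => ENNReal.ofReal (sfCut (θBal F.L γ b₀ p₀ (j + 1)) U)))) → (∀ j : ℕ, Ts ≤ j → j < T → μ j = Measure.map (descend F ℰp j) (μ (j + 1)) ∧ μ' j = Measure.map (descend F ℰp j) (μ' (j + 1))) → (∀ j : ℕ, j ≤ T → IsFiniteMeasure (μ j) ∧ IsFiniteMeasure (μ' j)) → (∀ j : ℕ, j₀ ≤ j → j ≤ T → ((∀ U, PlaqSmall (θBal F.L γ b₀ p₀ j) U → 0 < ρ j U ∧ 0 < ρ' j U) ∧ μ j = (fieldMeasure _ _ _).withDensity (fun U => ENNReal.ofReal (ρ j U)) ∧ μ' j = (fieldMeasure _ _ _).withDensity (fun U => ENNReal.ofReal (ρ' j U)) ∧ (∃ κ : ℝ, MemAtHeight F ℰp j (prm j) (fun U => Real.exp κ * ρ j U)) ∧ (∃ κ : ℝ, MemAtHeight F ℰp j (prm j) (fun U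 => Real.exp κ * ρ' j U)) ∧ μ j {U | ¬ PlaqSmall (θBal F.L γ b₀ p₀ j) U} ≤ ENNReal.ofReal (η j) ∧ μ' j {U | ¬ PlaqSmall (θBal F.L γ b₀ p₀ j) U} ≤ ENNReal.ofReal (η j) ∧ (ContinuousOn (ρ j) {U | PlaqSmall (θBal F.L γ b₀ p₀ j) U} ∧ ContinuousOn (ρ' j) {U | PlaqSmall (θBal F.L γ b₀ p₀ j) U}))) → ∀ (j : ℕ), j₁ ≤ j → j + 2 ≤ T → j + 1 ≤ Ts → ∀ (σ : ProbabilityTheory.Kernel (GaugeField (F.P j) 0 ↥(Matrix.specialUnitaryGroup (Fin 2) ℂ)) (GaugeField (F.P (j + 1)) 0 ↥(Matrix.specialUnitaryGroup (Fin 2) ℂ))), ProbabilityTheory.IsMarkovKernel σ → (Measure.map (descend F ℰp j) (fieldMeasure (F.P (j + 1)) 0 ↥(Matrix.specialUnitaryGroup (Fin 2) ℂ))).bind ⇑σ = fieldMeasure (F.P (j + 1)) 0 ↥(Matrix.specialUnitaryGroup (Fin 2) ℂ) → (∀ᵐ V ∂(Measure.map (descend F ℰp j) (fieldMeasure (F.P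 (j + 1)) 0 ↥(Matrix.specialUnitaryGroup (Fin 2) ℂ))), ∀ᵐ U ∂(σ V), descend F ℰp j U = V) → ∀ (m : GaugeField (F.P j) 0 ↥(Matrix.specialUnitaryGroup (Fin 2) ℂ) → ℝ), ContinuousOn m {V | PlaqSmall (θBal F.L γ b₀ p₀ j) V} → (∀ᵐ V ∂(fieldMeasure (F.P j) 0 ↥(Matrix.specialUnitaryGroup (Fin 2) ℂ)), PlaqSmall (θBal F.L γ b₀ p₀ j) V → MeasureTheory.Integrable (fun U => sfCut (θBal F.L γ b₀ p₀ (j + 1)) U * (Real.log (ρ (j + 1) U) - Real.log (ρ' (j + 1) U)) * ρ' (j + 1) U) (σ V) ∧ m V = (∫ U, sfCut (θBal F.L γ b₀ p₀ (j + 1)) U * (Real.log (ρ (j + 1) U) - Real.log (ρ' (j + 1) U)) * ρ' (j + 1) U ∂(σ V)) / (∫ U, sfCut (θBal F.L γ b₀ p₀ (j + 1)) U * ρ' (j + 1) U ∂(σ V))) → ∀ (Us : GaugeField (F.P j) 0 ↥(Matrix.specialUnitaryGroup (Fin 2) ℂ) → GaugeField (F.P (j + 1)) 0 ↥(Matrix.specialUnitaryGroup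 (Fin 2) ℂ)), ContinuousOn Us {V | PlaqSmall (θBal F.L γ b₀ p₀ j) V} → (∀ V, PlaqSmall (θBal F.L γ b₀ p₀ j) V → descend F ℰp j (Us V) = V ∧ PlaqSmall (θBal F.L γ b₀ p₀ (j + 1)) (Us V) ∧ ∀ U, descend F ℰp j U = V → PlaqSmall (θBal F.L γ b₀ p₀ (j + 1)) U → wilsonAction4 (Us V) ≤ wilsonAction4 U) → ∀ (c : Plaq (F.P (j + 1)) 0 → ℝ) (a w : ℝ), 0 ≤ a → 0 ≤ w → a + θ / (((F.L : ℝ) ^ (j + 1) / γ) * θBal F.L γ b₀ p₀ (j + 1) ^ 2) * w ≤ w₀ → ((∀ p, |c p| ≤ a) ∧ (∀ (b b' : PBond (F.P (j + 1)) 0) U V W Z, PlaqSmall (θBal F.L γ b₀ p₀ (j + 1)) U → PlaqSmall (θBal F.L γ b₀ p₀ (j + 1)) V → PlaqSmall (θBal F.L γ b₀ p₀ (j + 1)) W → PlaqSmall (θBal F.L γ b₀ p₀ (j + 1)) Z → (∀ e, e ≠ b → U e = V e) → (∀ e, e ≠ b' → U e = W e) → (∀ e, e ≠ b' → V e = Z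 e) → (∀ e, e ≠ b → W e = Z e) → |(Real.log (ρ (j + 1) U) - Real.log (ρ' (j + 1) U) - ((F.L : ℝ) ^ (j + 1) / γ) * ∑ p, c p * (1 - reTr (GaugeField.plaqHol U p))) - (Real.log (ρ (j + 1) V) - Real.log (ρ' (j + 1) V) - ((F.L : ℝ) ^ (j + 1) / γ) * ∑ p, c p * (1 - reTr (GaugeField.plaqHol V p))) - ((Real.log (ρ (j + 1) W) - Real.log (ρ' (j + 1) W) - ((F.L : ℝ) ^ (j + 1) / γ) * ∑ p, c p * (1 - reTr (GaugeField.plaqHol W p))) - (Real.log (ρ (j + 1) Z) - Real.log (ρ' (j + 1) Z) - ((F.L : ℝ) ^ (j + 1) / γ) * ∑ p, c p * (1 - reTr (GaugeField.plaqHol Z p))))| ≤ w * Real.exp (-(κ * (b.src.tdist b'.src : ℝ))))) → ∃ (c' : Plaq (F.P j) 0 → ℝ) (a' w' : ℝ), 0 ≤ a' ∧ 0 ≤ w' ∧ a' + θ / (((F.L : ℝ) ^ j / γ) * θBal F.L γ b₀ p₀ j ^ 2) * w' ≤ ε j * (a + θ / (((F.L : ℝ) ^ (j + 1) / γ) * θBal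 F.L γ b₀ p₀ (j + 1) ^ 2) * w) + δ j ∧ ((∀ p, |c' p| ≤ a') ∧ (∀ (b b' : PBond (F.P j) 0) U V W Z, PlaqSmall (θBal F.L γ b₀ p₀ j) U → PlaqSmall (θBal F.L γ b₀ p₀ j) V → PlaqSmall (θBal F.L γ b₀ p₀ j) W → PlaqSmall (θBal F.L γ b₀ p₀ j) Z → (∀ e, e ≠ b → U e = V e) → (∀ e, e ≠ b' → U e = W e) → (∀ e, e ≠ b' → V e = Z e) → (∀ e, e ≠ b → W e = Z e) → |(m U - (Real.log (ρ (j + 1) (Us U)) - Real.log (ρ' (j + 1) (Us U))) - ((F.L : ℝ) ^ j / γ) * ∑ p, c' p * (1 - reTr (GaugeField.plaqHol U p))) - (m V - (Real.log (ρ (j + 1) (Us V)) - Real.log (ρ' (j + 1) (Us V))) - ((F.L : ℝ) ^ j / γ) * ∑ p, c' p * (1 - reTr (GaugeField.plaqHol V p))) - ((m W - (Real.log (ρ (j + 1) (Us W)) - Real.log (ρ' (j + 1) (Us W))) - ((F.L : ℝ) ^ j / γ) * ∑ p, c' p * (1 - reTr (GaugeField.plaqHol W p))) - (m Z - (Real.log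 (ρ (j + 1) (Us Z)) - Real.log (ρ' (j + 1) (Us Z))) - ((F.L : ℝ) ^ j / γ) * ∑ p, c' p * (1 - reTr (GaugeField.plaqHol Z p))))| ≤ w' * Real.exp (-(κ * (b.src.tdist b'.src : ℝ)))))

/-- stub (MIN∘). -/
theorem stub_minimiserSection : MinimiserSectionCan := by
  sorry

/-- stub (BGEV∘). -/
theorem stub_classicalTransport : ClassicalTransportCan := by
  sorry

/-- stub (FLUC∘). -/
theorem stub_fluctuationCorrection : FluctuationCorrectionCan := by
  sorry

/-- ★ JUNCTION 1 (kernel-checked, no sorry): classical transport + fluctuation correction re-assemble the tangent row.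
`m = h∘U⋆ + (m − h∘U⋆)` pointwise; `c′ := c⋆ + c″`, `a′ := a⋆ + a″`, `w′ := w⋆ + w″`, `ε := εᴮ + εᶠ`, `εd := εdᴮ`, `δ := δᴮ + δᶠ`
(floor class closed under `+`), `κ₀ := min`, `θ₀ := min`, `w₀ := min`, `γ₁ := min (min γᴮ γᶠ) 1`, `j₁ := max (max jᴮ jᶠ) jᴹ`. -/
theorem tangentTransport_of_classicalQuantum
    (hM : MinimiserSectionCan) (hB : ClassicalTransportCan) (hF : FluctuationCorrectionCan) :
    TangentTransportCan := by
  obtain ⟨γB, hγB, hB⟩ := hB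
  obtain ⟨γF, hγF, hF⟩ := hF
  refine ⟨min (min γB γF) 1, lt_min (lt_min hγB hγF) one_pos, ?_⟩
  intro F γ hγ hγ1 b₀ p₀ j₀ prm η hb₀ hp₀ hadm hη0 hηs hηss hηt
  have hγB' : γ ≤ γB := hγ1.trans ((min_le_left _ _).trans (min_le_left _ _))
  have hγF' : γ ≤ γF := hγ1.trans ((min_le_left _ _).trans (min_le_right _ _))
  have hγone : γ ≤ 1 := hγ1.trans (min_le_right _ _)
  obtain ⟨jM, hM⟩ := hM F γ b₀ p₀ hγ hγone hb₀ hp₀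
  obtain ⟨κB, hκB, hB⟩ := hB F γ hγ hγB' b₀ p₀ j₀ prm η hb₀ hp₀ hadm hη0 hηs hηss hηt
  obtain ⟨κF, hκF, hF⟩ := hF F γ hγ hγF' b₀ p₀ j₀ prm η hb₀ hp₀ hadm hη0 hηs hηss hηt
  refine ⟨min κB κF, lt_min hκB hκF, ?_⟩
  intro κ hκ hκle
  obtain ⟨θB, hθB, hB⟩ := hB κ hκ (hκle.trans (min_le_left _ _))
  obtain ⟨θF, hθF, hF⟩ := hF κ hκ (hκle.trans (min_le_right _ _))
  refine ⟨min θB θF, lt_min hθB hθF, ?_⟩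
  intro θ hθ hθle
  obtain ⟨wB, εB, εd, δB, jB, hwB, hnnB, hεBs, hεds, hδBs, hδBss, hδBt, hjB, hB⟩ :=
    hB θ hθ (hθle.trans (min_le_left _ _))
  obtain ⟨wF, εF, δF, jF, hwF, hnnF, hεFs, hδFs, hδFss, hδFt, hjF, hF⟩ :=
    hF θ hθ (hθle.trans (min_le_right _ _))
  have h1 : ∀ i, Summable (fun k => δB (k + i)) := fun i => (summable_nat_add_iff i).mpr hδBs
  have h2 : ∀ i, Summable (fun k => δF (k + i)) := fun i => (summable_nat_add_iff i).mpr hδFs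
  refine ⟨min wB wF, fun j => εB j + εF j, εd, fun j => δB j + δF j, max (max jB jF) jM, lt_min hwB hwF, ?_,
    hεBs.add hεFs, hεds, hδBs.add hδFs, ?_, ?_, hjB.trans ((le_max_left _ _).trans (le_max_left _ _)), ?_⟩
  · intro j
    exact ⟨add_nonneg (hnnB j).1 (hnnF j).1, (hnnB j).2.1, add_nonneg (hnnB j).2.2 (hnnF j).2⟩
  · have key : (fun i => ∑' k, (δB (k + i) + δF (k + i))) =
        fun i => (∑' k, δB (k + i)) + ∑' k, δF (k + i) := by
      funext i
      exact (h1 i).tsum_add (h2 i)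
    rw [key]
    exact hδBss.add hδFss
  · have key : (fun j => (∑' k, (δB (k + j) + δF (k + j))) * ((1 + 2 * ((F.L : ℝ) ^ j / γ) * (Fintype.card (Plaq (F.P j) 0) : ℝ)) * (Fintype.card (PBond (F.P j) 0) : ℝ) ^ 2)) =
        fun j => (∑' k, δB (k + j)) * ((1 + 2 * ((F.L : ℝ) ^ j / γ) * (Fintype.card (Plaq (F.P j) 0) : ℝ)) * (Fintype.card (PBond (F.P j) 0) : ℝ) ^ 2) +
          (∑' k, δF (k + j)) * ((1 + 2 * ((F.L : ℝ) ^ j / γ) * (Fintype.card (Plaq (F.P j) 0) : ℝ)) * (Fintype.card (PBond (F.P j) 0) : ℝ) ^ 2) := by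
      funext j
      rw [(h1 j).tsum_add (h2 j), add_mul]
    rw [key]
    simpa using hδBt.add hδFt
  · intro ν hG hCν K K' hKK' Ts T hTs hTK μ μ' ρ ρ' hanch hcut hcons hfin hwin j hj hjT hjTs σ hσM hσb hσf m hmc hmae c a w ha hw hx hin
    have hjB' : jB ≤ j := ((le_max_left _ _).trans (le_max_left _ _)).trans hj
    have hjF' : jF ≤ j := ((le_max_right _ _).trans (le_max_left _ _)).trans hj
    have hjM' : jM ≤ j := (le_max_right _ _).trans hj
    obtain ⟨Us, hUc, hUs⟩ := hM j hjM'
    obtain ⟨c₁, a₁, w₁, ha₁, hw₁, hbd₁, hc₁, h4₁⟩ :=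
      hB ν hG hCν K K' hKK' Ts T hTs hTK μ μ' ρ ρ' hanch hcut hcons hfin hwin j hjB' hjT hjTs Us hUc hUs c a w ha hw (hx.trans (min_le_left _ _)) hin
    obtain ⟨c₂, a₂, w₂, ha₂, hw₂, hbd₂, hc₂, h4₂⟩ :=
      hF ν hG hCν K K' hKK' Ts T hTs hTK μ μ' ρ ρ' hanch hcut hcons hfin hwin j hjF' hjT hjTs σ hσM hσb hσf m hmc hmae Us hUc hUs c a w ha hw
        (hx.trans (min_le_right _ _)) hin
    refine ⟨fun p => c₁ p + c₂ p, a₁ + a₂, w₁ + w₂, add_nonneg ha₁ ha₂, add_nonneg hw₁ hw₂, ?_, ?_, ?_⟩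
    · linear_combination hbd₁ + hbd₂
    · intro p
      exact (abs_add_le _ _).trans (add_le_add (hc₁ p) (hc₂ p))
    · intro b b' U V W Z hU hV' hW hZ e1 e2 e3 e4
      have A := h4₁ b b' U V W Z hU hV' hW hZ e1 e2 e3 e4
      have B := h4₂ b b' U V W Z hU hV' hW hZ e1 e2 e3 e4
      have hsum := add_le_add A B
      rw [← add_mul] at hsum
      refine le_trans ?_ hsum
      refine le_trans (le_of_eq ?_) (abs_add_le _ _)
      congr 1
      simp only [add_mul, Finset.sum_add_distrib]
      ring

/-- ★ JUNCTION 2 (g25-1 v2's junction, re-proved here verbatim so that this file stands alone): VER∘ → LIN∘ → JEN∘ → O1. -/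
theorem oneStepContractionRun_of_tangentCut
    (hV : FibreMeanVersionCan) (hL : TangentTransportCan) (hJ : JensenGapCan) :
    OneStepContractionRun := by
  obtain ⟨γL, hγL, hL⟩ := hL
  obtain ⟨γJ, hγJ, hJ⟩ := hJ
  refine ⟨min (min γL γJ) 1, lt_min (lt_min hγL hγJ) one_pos, ?_⟩
  intro F γ hγ hγ1 b₀ p₀ j₀ prm η hb₀ hp₀ hadm hη0 hηs hηss hηt
  have hγone : γ ≤ 1 := hγ1.trans (min_le_right _ _)
  obtain ⟨jV, hV⟩ := hV F γ b₀ p₀ hγ hγone hb₀ hp₀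
  obtain ⟨κL, hκL, hL⟩ := hL F γ hγ (hγ1.trans ((min_le_left _ _).trans (min_le_left _ _))) b₀ p₀ j₀ prm η hb₀ hp₀ hadm hη0 hηs hηss hηt
  obtain ⟨κJ, hκJ, hJ⟩ := hJ F γ hγ (hγ1.trans ((min_le_left _ _).trans (min_le_right _ _))) b₀ p₀ j₀ prm η hb₀ hp₀ hadm hη0 hηs hηss hηt
  refine ⟨min κL κJ, lt_min hκL hκJ, ?_⟩
  intro κ hκ hκle
  obtain ⟨θL, hθL, hL⟩ := hL κ hκ (hκle.trans (min_le_left _ _))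
  obtain ⟨θJ, hθJ, hJ⟩ := hJ κ hκ (hκle.trans (min_le_right _ _))
  obtain ⟨wL, ε, εd, δL, jL, hwL, hnnL, hεs, hεds, hδLs, hδLss, hδLt, hjL, hL⟩ :=
    hL (min θL θJ) (lt_min hθL hθJ) (min_le_left _ _)
  obtain ⟨C, wJ, δJ, jJ, hC, hwJ, hnnJ, hδJs, hδJss, hδJt, hjJ, hJ⟩ :=
    hJ (min θL θJ) (lt_min hθL hθJ) (min_le_right _ _)
  have h1 : ∀ i, Summable (fun k => δL (k + i)) := fun i => (summable_nat_add_iff i).mpr hδLs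
  have h2 : ∀ i, Summable (fun k => δJ (k + i)) := fun i => (summable_nat_add_iff i).mpr hδJs
  refine ⟨min θL θJ, C, min wL wJ, ε, εd, fun j => δL j + δJ j, max (max jL jJ) jV, lt_min hθL hθJ, hC, lt_min hwL hwJ, ?_,
    hεs, hεds, hδLs.add hδJs, ?_, ?_, hjL.trans ((le_max_left jL jJ).trans (le_max_left (max jL jJ) jV)), ?_⟩
  · intro j
    exact ⟨(hnnL j).1, (hnnL j).2.1, add_nonneg (hnnL j).2.2 (hnnJ j)⟩
  · have key : (fun i => ∑' k, (δL (k + i) + δJ (k + i))) =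
        fun i => (∑' k, δL (k + i)) + ∑' k, δJ (k + i) := by
      funext i
      exact (h1 i).tsum_add (h2 i)
    rw [key]
    exact hδLss.add hδJss
  · have key : (fun j => (∑' k, (δL (k + j) + δJ (k + j))) * ((1 + 2 * ((F.L : ℝ) ^ j / γ) * (Fintype.card (Plaq (F.P j) 0) : ℝ)) * (Fintype.card (PBond (F.P j) 0) : ℝ) ^ 2)) =
        fun j => (∑' k, δL (k + j)) * ((1 + 2 * ((F.L : ℝ) ^ j / γ) * (Fintype.card (Plaq (F.P j) 0) : ℝ)) * (Fintype.card (PBond (F.P j) 0) : ℝ) ^ 2) +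
          (∑' k, δJ (k + j)) * ((1 + 2 * ((F.L : ℝ) ^ j / γ) * (Fintype.card (Plaq (F.P j) 0) : ℝ)) * (Fintype.card (PBond (F.P j) 0) : ℝ) ^ 2) := by
      funext j
      rw [(h1 j).tsum_add (h2 j), add_mul]
    rw [key]
    simpa using hδLt.add hδJt
  · intro ν hG hCν K K' hKK' Ts T hTs hTK μ μ' ρ ρ' hanch hcut hcons hfin hwin j hj hjT hjTs c a w ha hw hx hin
    obtain ⟨σ, hσM, hσb, hσf⟩ :=
      Summit.QuantumFields.YangMills.Theorems.BackwardLiouvilleRigidity.FibreLaplace.stub_descentDisintegration F j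
    have hjLJ : max jL jJ ≤ j := (le_max_left (max jL jJ) jV).trans hj
    have hj₀ : j₀ ≤ j := hjL.trans ((le_max_left jL jJ).trans hjLJ)
    have hjT' : j + 1 ≤ T := by omega
    obtain ⟨m, hmc, hmae⟩ :=
      hV j₀ prm η ν hG hCν K K' hKK' Ts T hTs hTK μ μ' ρ ρ' hanch hcut hcons hfin hwin j ((le_max_right (max jL jJ) jV).trans hj) hj₀ hjT' σ hσM hσb hσf
    obtain ⟨c', a', w₁, ha', hw₁, hbdL, hc', h4L⟩ :=
      hL ν hG hCν K K' hKK' Ts T hTs hTK μ μ' ρ ρ' hanch hcut hcons hfin hwin j ((le_max_left jL jJ).trans hjLJ) hjT hjTs σ hσM hσb hσf m hmc hmae c a w ha hw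
        (hx.trans (min_le_left _ _)) hin
    obtain ⟨w₂, hw₂, hbdJ, h4J⟩ :=
      hJ ν hG hCν K K' hKK' Ts T hTs hTK μ μ' ρ ρ' hanch hcut hcons hfin hwin j ((le_max_right jL jJ).trans hjLJ) hjT hjTs σ hσM hσb hσf m hmc hmae c a w ha hw
        (hx.trans (min_le_right _ _)) hin
    refine ⟨c', a', w₁ + w₂, ha', add_nonneg hw₁ hw₂, ?_, hc', ?_⟩
    · linear_combination hbdL + hbdJ
    · intro b b' U V W Z hU hV' hW hZ e1 e2 e3 e4
      have A := h4L b b' U V W Z hU hV' hW hZ e1 e2 e3 e4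
      have B := h4J b b' U V W Z hU hV' hW hZ e1 e2 e3 e4
      have hsum := add_le_add A B
      rw [← add_mul] at hsum
      refine le_trans ?_ hsum
      refine le_trans (le_of_eq ?_) (abs_add_le _ _)
      congr 1
      ring


/-- ★ JUNCTION 3 (composition): the five rows of the two Taylor cuts give the one-step organ. -/
theorem oneStepContractionRun_of_classicalQuantumCut
    (hV : FibreMeanVersionCan) (hM : MinimiserSectionCan) (hB : ClassicalTransportCan)
    (hF : FluctuationCorrectionCan) (hJ : JensenGapCan) : OneStepContractionRun :=
  oneStepContractionRun_of_tangentCut hV (tangentTransport_of_classicalQuantum hM hB hF) hJ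

end Summit.QuantumFields.YangMills.Cruxes.FluctuationComparisonRegPrIntL.TangentClassicalQuantum
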